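import Summits.CriticalPhenomena.PercolationContinuityZ3.Theorems.PercNearOneGluingNoHeavyLowerTailE3GroupSepLeFive

/-!
# `NoHeavyLowerTail` (crux stmt-CriticalPhenomena-4575): the three-point rows `H_{q+t}`, AG⁺ and SHK3⁺ hold on every weighted graph with
# at most five vertices — kernel-checked, and three-copy FIBREWISE (Richards-comb) positive

Support file (certificate seat `prim-cert-2`; `--supports stmt-CriticalPhenomena-4575`; COMPUTATIONAL: the `checkC` evaluations use
`native_decide`).

For three terminals `a, b, c` of a weighted graph let `(q, u₁, u₂, u₃, t)` be the three-point law (`q` = all three separated, `u₁ = {a↔b}∖{a↔c}`,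
`u₂ = {a↔c}∖{a↔b}`, `u₃ = {b↔c}∖{a↔b}`, `t` = all three joined; `e₂ = u₁u₂+u₁u₃+u₂u₃`, `e₃ = u₁u₂u₃`).  The 4575 inequality programme needs
(run/shared/lean/ttrl/bern4, sahi/AGPLUS.md, LEAD-GEN6 §4; all 0 violations in ttrl2's censuses, none proved):

  `H_{q+t}`:  `(q + t)(qt − e₂) − e₃ ≥ 0`   ⟹   AG⁺ (= Ξ = G3):  `qt − e₂ − e₃ ≥ 0`   ⟹   SHK3⁺ (= 3PT-LB):  `(1 + t)(qt − e₂) − e₃ ≥ 0`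

(the implications use `q + t ≤ 1` and Kozma–Nitzan's `qt ≥ e₂`); SHK3⁺ is the target of the terminal-edge Bernstein induction
(`…CubicThreePointInduction`, `shk3_of_stepHyp`), whose step does not close over proved rows but nearly closes with a proved `H_{q+t}` (bern4/SDP.md).

**Theorems `hqt_le_five`, `agPlus_le_five`, `shk3Plus_le_five`.**  For every `n ≤ 5`, every `w : Sym2 (Fin n) → [0,1]` and all pairwise distinct
`a b c : Fin n`, the three rows hold (as inequalities between products of `prodBernoulli w`-probabilities of the five pattern events).  Proof: each
row is a signed cubic form in three-copy tensor-Bernstein coordinates; the checker `checkC` of `…E3GroupSepCertCheck` verifies that ALL `4^m` fibre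
sums are nonnegative at the terminal triple `(0,1,2)` of `K₃, K₄, K₅` (`native_decide`), and the other triples follow by transport along vertex
relabellings.  So on `≤ 5` vertices the three rows are Richards-comb positive — the signature of a three-copy switching proof; the single branches
`q(qt−e₂) − e₃`, `t(qt−e₂) − e₃` of `H_max` are NOT comb positive (negative fibres already on `K₄`; census work/e3 of this seat, kit j069285 for `K₆` and
random `n ≤ 8`).  Nothing here is claimed beyond five vertices.
-/

namespace Summit.CriticalPhenomena.PercolationContinuityZ3.Theorems.E3GroupSepCert

open Finset MeasureTheory OneCutCert CovTransferCert
open scoped BigOperators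
open Literature.Probability.Percolation Literature.Probability.LatticeModels

variable {n : ℕ}

/-! ## The five pattern events of three terminals -/

/-- `q`: the three terminals are pairwise separated. [this work] -/
def pQ (a b c : Fin n) : CRel n → Bool := fun r => !(r a b) && !(r a c) && !(r b c)
/-- `u₁`: `a ↔ b` and `a ↮ c`. [this work] -/
def pU₁ (a b c : Fin n) : CRel n → Bool := fun r => r a b && !(r a c)
/-- `u₂`: `a ↔ c` and `a ↮ b`. [this work] -/
def pU₂ (a b c : Fin n) : CRel n → Bool := fun r => r a c && !(r a b)
/-- `u₃`: `b ↔ c` and `a ↮ b`. [this work] -/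
def pU₃ (a b c : Fin n) : CRel n → Bool := fun r => r b c && !(r a b)
/-- `t`: `a ↔ b` and `a ↔ c`. [this work] -/
def pT (a b c : Fin n) : CRel n → Bool := fun r => r a b && r a c

/-- A terminal triple. [this work] -/
abbrev Tri (n : ℕ) : Type := Fin n × Fin n × Fin n

/-- The cubic terms of the three rows at the triple `t = (a,b,c)`: `0 = H_{q+t} = q²t + qt² − q e₂ − t e₂ − e₃`, `1 = AG⁺ = qt − e₂ − e₃`,
`2 = SHK3⁺ = qt + qt² − e₂ − t e₂ − e₃`. [this work] -/
def rowTerms (i : Fin 3) (t : Tri n) : List (CTerm n) :=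
  let Q := pQ t.1 t.2.1 t.2.2
  let U₁ := pU₁ t.1 t.2.1 t.2.2
  let U₂ := pU₂ t.1 t.2.1 t.2.2
  let U₃ := pU₃ t.1 t.2.1 t.2.2
  let T := pT t.1 t.2.1 t.2.2
  match i with
  | 0 => [(1, Q, T, Q), (1, Q, T, T), (-1, U₁, U₂, Q), (-1, U₁, U₃, Q), (-1, U₂, U₃, Q), (-1, U₁, U₂, T), (-1, U₁, U₃, T), (-1, U₂, U₃, T),
      (-1, U₁, U₂, U₃)]
  | 1 => [(1, Q, T, pTrue), (-1, U₁, U₂, pTrue), (-1, U₁, U₃, pTrue), (-1, U₂, U₃, pTrue), (-1, U₁, U₂, U₃)]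
  | 2 => [(1, Q, T, pTrue), (1, Q, T, T), (-1, U₁, U₂, pTrue), (-1, U₁, U₃, pTrue), (-1, U₂, U₃, pTrue), (-1, U₁, U₂, T), (-1, U₁, U₃, T),
      (-1, U₂, U₃, T), (-1, U₁, U₂, U₃)]

/-- Row `i` holds at `(w, t)`: its cubic form is nonnegative. [this work] -/
def TRowHolds (i : Fin 3) (w : Sym2 (Fin n) → unitInterval) (t : Tri n) : Prop := 0 ≤ cval w (rowTerms i t)

/-! ## Transport along vertex relabellings -/

/-- A triple relabelled. [this work] -/
def trimap (τ : Fin n ≃ Fin n) (t : Tri n) : Tri n := (τ t.1, τ t.2.1, τ t.2.2)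

/-- `trimap σ.symm ∘ trimap σ = id`. [this work] -/
theorem trimap_symm_trimap (σ : Fin n ≃ Fin n) (t : Tri n) : trimap σ.symm (trimap σ t) = t := by
  obtain ⟨a, b, c⟩ := t
  simp [trimap]

/-- `cval` of terms read through a relabelling equals `cval` at the relabelled weights. [this work] -/
theorem cval_map_relP (σ : Fin n ≃ Fin n) (w : Sym2 (Fin n) → unitInterval) (ts : List (CTerm n)) :
    cval (relabelW σ w) ts = cval w (ts.map fun x => (x.1, relP σ.symm x.2.1, relP σ.symm x.2.2.1, relP σ.symm x.2.2.2)) := by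
  unfold cval pr
  rw [List.map_map]
  congr 1
  refine List.map_congr_left fun x _ => ?_
  simp only [Function.comp, ← prodBernoulli_real_preimage_relabel (sym2Equiv σ) w (relabelW σ w) (relabelW_apply σ w),
    preimage_relabel_connEvent]

/-- The row terms under relabelling. [this work] -/
theorem rowTerms_relP (i : Fin 3) (τ : Fin n ≃ Fin n) (t : Tri n) :
    ((rowTerms i t).map fun x => (x.1, relP τ x.2.1, relP τ x.2.2.1, relP τ x.2.2.2)) = rowTerms i (trimap τ t) := by
  obtain ⟨a, b, c⟩ := t
  fin_cases i <;> rfl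

/-- **A row is transported along a relabelling of the vertices.** [this work] -/
theorem tRowHolds_relabel (i : Fin 3) (σ : Fin n ≃ Fin n) (w : Sym2 (Fin n) → unitInterval) (t : Tri n)
    (h : TRowHolds i w t) : TRowHolds i (relabelW σ w) (trimap σ t) := by
  unfold TRowHolds at h ⊢
  rw [cval_map_relP, rowTerms_relP, trimap_symm_trimap]
  exact h

/-- A row at all weights for a triple gives the row at all weights for every relabelled triple. [this work] -/
theorem tRowHolds_forall_relabel (i : Fin 3) (σ : Fin n ≃ Fin n) {t : Tri n}
    (h : ∀ w : Sym2 (Fin n) → unitInterval, TRowHolds i w t) (w : Sym2 (Fin n) → unitInterval) :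
    TRowHolds i w (trimap σ t) := by
  have hw : relabelW σ (fun e => w (sym2Equiv σ e)) = w := by
    funext e
    unfold relabelW
    simp only [Equiv.apply_symm_apply]
  rw [← hw]
  exact tRowHolds_relabel i σ _ t (h _)

/-! ## Distinct triples and the evaluations -/

/-- All triples of `Fin n`. [this work] -/
def allTri (n : ℕ) : List (Tri n) :=
  (List.finRange n).flatMap fun a => (List.finRange n).flatMap fun b => (List.finRange n).map fun c => (a, b, c)

/-- Every triple is listed. [this work] -/
theorem mem_allTri (a b c : Fin n) : (a, b, c) ∈ allTri n := by
  simp [allTri, List.mem_flatMap, List.mem_map]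

/-- Triples with pairwise distinct entries. [this work] -/
def distinctTri (n : ℕ) : List (Tri n) := (allTri n).filter fun t => decide (t.1 ≠ t.2.1 ∧ t.1 ≠ t.2.2 ∧ t.2.1 ≠ t.2.2)

/-- A pairwise distinct triple is listed. [this work] -/
theorem mem_distinctTri {a b c : Fin n} (hab : a ≠ b) (hac : a ≠ c) (hbc : b ≠ c) : (a, b, c) ∈ distinctTri n := by
  unfold distinctTri
  rw [List.mem_filter]
  exact ⟨mem_allTri a b c, by simp [hab, hac, hbc]⟩

/-- The standard triple. [this work] -/
def tri₀ (n : ℕ) (h : 3 ≤ n) : Tri n := (⟨0, by omega⟩, ⟨1, by omega⟩, ⟨2, by omega⟩)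

/-- Cover of the distinct triples of `Fin 3` by relabellings of the standard one. [this work] -/
theorem cover_tri3 : ∀ t ∈ distinctTri 3, ∃ σ : Equiv.Perm (Fin 3), trimap σ (tri₀ 3 le_rfl) = t := by native_decide
/-- Cover of the distinct triples of `Fin 4`. [this work] -/
theorem cover_tri4 : ∀ t ∈ distinctTri 4, ∃ σ : Equiv.Perm (Fin 4), trimap σ (tri₀ 4 (by norm_num)) = t := by native_decide
/-- Cover of the distinct triples of `Fin 5`. [this work] -/
theorem cover_tri5 : ∀ t ∈ distinctTri 5, ∃ σ : Equiv.Perm (Fin 5), trimap σ (tri₀ 5 (by norm_num)) = t := by native_decide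

/-- `K₃`: the three rows pass the three-copy check at the standard triple (base `2^14`). [this work] -/
theorem checkTri3 (i : Fin 3) : checkC 3 14 (rowTerms i (tri₀ 3 le_rfl)) = true := by
  fin_cases i <;> native_decide
/-- `K₄`: the three rows pass the three-copy check at the standard triple (base `2^23`). [this work] -/
theorem checkTri4 (i : Fin 3) : checkC 4 23 (rowTerms i (tri₀ 4 (by norm_num))) = true := by
  fin_cases i <;> native_decide
/-- `K₅`: the three rows pass the three-copy check at the standard triple (base `2^35`). [this work] -/
theorem checkTri5 (i : Fin 3) : checkC 5 35 (rowTerms i (tri₀ 5 (by norm_num))) = true := by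
  fin_cases i <;> native_decide

/-- The rows on `Fin 3`. [this work] -/
theorem tRowHolds_three (i : Fin 3) (w : Sym2 (Fin 3) → unitInterval) (a b c : Fin 3) (hab : a ≠ b) (hac : a ≠ c) (hbc : b ≠ c) :
    TRowHolds i w (a, b, c) := by
  obtain ⟨σ, hσ⟩ := cover_tri3 _ (mem_distinctTri hab hac hbc)
  rw [← hσ]
  exact tRowHolds_forall_relabel i σ (fun w' => checkC_sound 14 _ (checkTri3 i) w') w

/-- The rows on `Fin 4`. [this work] -/
theorem tRowHolds_four (i : Fin 3) (w : Sym2 (Fin 4) → unitInterval) (a b c : Fin 4) (hab : a ≠ b) (hac : a ≠ c) (hbc : b ≠ c) :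
    TRowHolds i w (a, b, c) := by
  obtain ⟨σ, hσ⟩ := cover_tri4 _ (mem_distinctTri hab hac hbc)
  rw [← hσ]
  exact tRowHolds_forall_relabel i σ (fun w' => checkC_sound 23 _ (checkTri4 i) w') w

/-- The rows on `Fin 5`. [this work] -/
theorem tRowHolds_five (i : Fin 3) (w : Sym2 (Fin 5) → unitInterval) (a b c : Fin 5) (hab : a ≠ b) (hac : a ≠ c) (hbc : b ≠ c) :
    TRowHolds i w (a, b, c) := by
  obtain ⟨σ, hσ⟩ := cover_tri5 _ (mem_distinctTri hab hac hbc)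
  rw [← hσ]
  exact tRowHolds_forall_relabel i σ (fun w' => checkC_sound 35 _ (checkTri5 i) w') w

/-- **The three rows on every weighted graph with at most five vertices**, for all pairwise distinct terminals. [this work] -/
theorem tRowHolds_le_five (i : Fin 3) : ∀ n ≤ 5, ∀ (w : Sym2 (Fin n) → unitInterval) (a b c : Fin n), a ≠ b → a ≠ c → b ≠ c →
    TRowHolds i w (a, b, c) := by
  intro n hn w a b c hab hac hbc
  interval_cases n
  · exact a.elim0
  · exact absurd (Subsingleton.elim a b) hab
  · have : c = a ∨ c = b := by omega
    rcases this with h | h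
    · exact absurd h.symm hac
    · exact absurd h.symm hbc
  · exact tRowHolds_three i w a b c hab hac hbc
  · exact tRowHolds_four i w a b c hab hac hbc
  · exact tRowHolds_five i w a b c hab hac hbc

/-! ## The rows in probability notation -/

section Statements

variable (w : Sym2 (Fin n) → unitInterval) (a b c : Fin n)

/-- `q = μ(a, b, c pairwise separated)`. [this work] -/
noncomputable def lq : ℝ := (prodBernoulli w).real (connEvent (pQ a b c))
/-- `u₁ = μ(a ↔ b, a ↮ c)`. [this work] -/
noncomputable def lu₁ : ℝ := (prodBernoulli w).real (connEvent (pU₁ a b c))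
/-- `u₂ = μ(a ↔ c, a ↮ b)`. [this work] -/
noncomputable def lu₂ : ℝ := (prodBernoulli w).real (connEvent (pU₂ a b c))
/-- `u₃ = μ(b ↔ c, a ↮ b)`. [this work] -/
noncomputable def lu₃ : ℝ := (prodBernoulli w).real (connEvent (pU₃ a b c))
/-- `t = μ(a ↔ b, a ↔ c)`. [this work] -/
noncomputable def lt : ℝ := (prodBernoulli w).real (connEvent (pT a b c))

/-- The event `q` in `openConn` notation. [this work] -/
theorem connEvent_pQ : connEvent (pQ a b c) = (openConn a b)ᶜ ∩ (openConn a c)ᶜ ∩ (openConn b c)ᶜ := by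
  ext ω; simp [connEvent, pQ, and_assoc]
/-- The event `u₁` in `openConn` notation. [this work] -/
theorem connEvent_pU₁ : connEvent (pU₁ a b c) = openConn a b ∩ (openConn a c)ᶜ := by
  ext ω; simp [connEvent, pU₁]
/-- The event `u₂` in `openConn` notation. [this work] -/
theorem connEvent_pU₂ : connEvent (pU₂ a b c) = openConn a c ∩ (openConn a b)ᶜ := by
  ext ω; simp [connEvent, pU₂]
/-- The event `u₃` in `openConn` notation. [this work] -/
theorem connEvent_pU₃ : connEvent (pU₃ a b c) = openConn b c ∩ (openConn a b)ᶜ := by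
  ext ω; simp [connEvent, pU₃]
/-- The event `t` in `openConn` notation. [this work] -/
theorem connEvent_pT : connEvent (pT a b c) = openConn a b ∩ openConn a c := by
  ext ω; simp [connEvent, pT]

end Statements

/-- **`H_{q+t}` on at most five vertices**: `(q + t)(qt − e₂) − e₃ ≥ 0`. [this work] -/
theorem hqt_le_five : ∀ n ≤ 5, ∀ (w : Sym2 (Fin n) → unitInterval) (a b c : Fin n), a ≠ b → a ≠ c → b ≠ c →
    0 ≤ (lq w a b c + lt w a b c) * (lq w a b c * lt w a b c -
      (lu₁ w a b c * lu₂ w a b c + lu₁ w a b c * lu₃ w a b c + lu₂ w a b c * lu₃ w a b c)) - lu₁ w a b c * lu₂ w a b c * lu₃ w a b c := by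
  intro n hn w a b c hab hac hbc
  have h := tRowHolds_le_five 0 n hn w a b c hab hac hbc
  unfold TRowHolds cval rowTerms at h
  simp only [List.map_cons, List.map_nil, List.sum_cons, List.sum_nil] at h
  unfold pr at h
  unfold lq lt lu₁ lu₂ lu₃
  push_cast at h
  linarith

/-- **AG⁺ (`Ξ = G3`) on at most five vertices**: `qt − e₂ − e₃ ≥ 0`. [this work] -/
theorem agPlus_le_five : ∀ n ≤ 5, ∀ (w : Sym2 (Fin n) → unitInterval) (a b c : Fin n), a ≠ b → a ≠ c → b ≠ c →
    lu₁ w a b c * lu₂ w a b c + lu₁ w a b c * lu₃ w a b c + lu₂ w a b c * lu₃ w a b c + lu₁ w a b c * lu₂ w a b c * lu₃ w a b c ≤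
      lq w a b c * lt w a b c := by
  intro n hn w a b c hab hac hbc
  have h := tRowHolds_le_five 1 n hn w a b c hab hac hbc
  unfold TRowHolds cval rowTerms at h
  simp only [List.map_cons, List.map_nil, List.sum_cons, List.sum_nil, pr_pTrue] at h
  unfold pr at h
  unfold lq lt lu₁ lu₂ lu₃
  push_cast at h
  linarith

/-- **SHK3⁺ (`3PT-LB`) on at most five vertices**: `(1 + t)(qt − e₂) − e₃ ≥ 0`. [this work] -/
theorem shk3Plus_le_five : ∀ n ≤ 5, ∀ (w : Sym2 (Fin n) → unitInterval) (a b c : Fin n), a ≠ b → a ≠ c → b ≠ c →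
    0 ≤ (1 + lt w a b c) * (lq w a b c * lt w a b c -
      (lu₁ w a b c * lu₂ w a b c + lu₁ w a b c * lu₃ w a b c + lu₂ w a b c * lu₃ w a b c)) - lu₁ w a b c * lu₂ w a b c * lu₃ w a b c := by
  intro n hn w a b c hab hac hbc
  have h := tRowHolds_le_five 2 n hn w a b c hab hac hbc
  unfold TRowHolds cval rowTerms at h
  simp only [List.map_cons, List.map_nil, List.sum_cons, List.sum_nil, pr_pTrue] at h
  unfold pr at h
  unfold lq lt lu₁ lu₂ lu₃
  push_cast at h
  linarith

end Summit.CriticalPhenomena.PercolationContinuityZ3.Theorems.E3GroupSepCert
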